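import Literature.AlgebraicGeometry.ComplexMultiplication.TateModuleOfCMFreeRankOne
import Literature.AlgebraicGeometry.Motives.AbelianVarietyGoodReductionFrobenius
import Mathlib.LinearAlgebra.Dual.Lemmas
import HarnessLib

/-!
# A non-zero `χ`-eigen DUAL Tate class: `∃ f ≠ 0` in `R ⊗_{ℚ_ℓ} (V_ℓ A)^∨` with `ᵗ(V_ℓ^ℚ(i a)) f = χ(a) f` for a full-degree rational CM structure

Topic `AlgebraicGeometry/ComplexMultiplication`; namespaces `Literature.LinearAlgebra.BaseChange` (§1, generic) and
`Literature.AlgebraicGeometry.ComplexMultiplication` (§2).  THEOREMS ONLY (no definition, no named fact, no instance, no `sorry`).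
Cell hodgecm-mathlib, d6 line, residual **(E1)** of the S2′-body probe (A-p11 (g11) `S2primeBodyProbe`, hypothesis (H3) `EigenClassShape`;
A-plan2 (g11) dispatch 2026-08-29T22:29:37Z): the socket ★ p739802′ and the probe quantify over a `τ`-eigen class `f` of `ℚ̄_ℓ ⊗ (V_ℓ B)^∨`;
this file PRODUCES a non-zero one for every character.

MATHEMATICS ([SerreTate1968] §4 Thm. 5 (i): `V_ℓ A` is free of rank one over `F_ℓ = ℚ_ℓ ⊗ F` when `[F:ℚ] = 2 dim A`, ★
`exists_bijective_cmTateAction`; [Shimura1998] §5.1 Prop. 1 (the eigen-decomposition under the CM field)): along `F_ℓ ≅ V_ℓ A`, `s ↦ s·v₀`,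
the action of `a ∈ F` is multiplication by `1 ⊗ a`, so the `ℚ_ℓ`-algebra map `χ_ℓ : F_ℓ → R` extending `χ : F → R` is a NON-ZERO
`ℚ_ℓ`-linear functional `χ̃` on `V_ℓ A` with `χ̃ ∘ V_ℓ^ℚ(i a) = χ(a) χ̃`; §1 turns any such functional into the element
`f = Σ_j χ̃(v_j) ⊗ v_j^*` of `R ⊗ (V_ℓ A)^∨` (dual-basis expansion), which is `χ`-eigen for the transposed action and non-zero.

CONTENT: §1 `exists_ne_zero_dualMap_baseChange_eq_smul_of_linearMap` (any field `k`, f.d. `V`, commutative `k`-algebra `R`, any family of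
endomorphisms with a joint «eigen-covector» `χ̃`); §2 **`AbelianVariety.exists_ne_zero_dualMap_rationalTateAction_baseChange_eq_smul`** (the (H3)
producer: `[F:ℚ] = 2 dim A`, `ℓ` invertible on the base, `R` a field over `ℚ_ℓ`, `χ : F →+* R`).
HC_CM is proved only modulo the 7 printed citations until rung 0 closes; nothing here moves a book.

## References
* [SerreTate1968] J.-P. Serre, J. Tate, *Good reduction of abelian varieties*, Ann. of Math. 88 (1968), §4 Thm. 5 (i) and Cor. 2.
* [Shimura1998] G. Shimura, *Abelian Varieties with Complex Multiplication and Modular Functions* (1998), §5.1 Prop. 1 (p. 36) (proof).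
-/

set_option autoImplicit false

noncomputable section

open scoped TensorProduct

/-! ## §1 Generic: a joint eigen-covector gives a non-zero eigen class in `R ⊗ V^∨` for the transposed action -/

namespace Literature.LinearAlgebra.BaseChange

variable {k : Type*} [Field k] {V : Type*} [AddCommGroup V] [Module k V] [FiniteDimensional k V]
  {R : Type*} [CommRing R] [Algebra k R]

/-- **Dual-basis packaging of an eigen-covector.**  Let `χ̃ : V → R` be a NON-ZERO `k`-linear map into a commutative `k`-algebra `R` and
`(T_a)` endomorphisms of `V` with `χ̃ ∘ T_a = c_a · χ̃`.  Then `f := Σ_j χ̃(v_j) ⊗ v_j^*` (for a basis `(v_j)` with dual basis `(v_j^*)`)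
is a non-zero element of `R ⊗_k V^∨` with `(ᵗT_a ⊗ 1) f = c_a • f` for all `a`. [cite: Shimura1998, §5.1 Prop. 1 (p. 36) (proof)]
[cite: SerreTate1968, §4 Thm. 5 (i)] -/
theorem exists_ne_zero_dualMap_baseChange_eq_smul_of_linearMap (χt : V →ₗ[k] R) (hχ : χt ≠ 0)
    {ι : Type*} (T : ι → Module.End k V) (c : ι → R) (hT : ∀ a v, χt (T a v) = c a * χt v) :
    ∃ f : R ⊗[k] Module.Dual k V, f ≠ 0 ∧ ∀ a, ((T a).dualMap).baseChange R f = c a • f := by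
  classical
  let b := Module.finBasis k V
  -- the dual-basis expansion read through `χ̃`
  have hsum : ∀ w : V, ∑ j, (b.coord j w) • χt (b j) = χt w := fun w => by
    conv_rhs => rw [← b.sum_repr w]
    simp only [map_sum, map_smul, Module.Basis.coord_apply]
  refine ⟨∑ j, χt (b j) ⊗ₜ[k] b.coord j, ?_, fun a => ?_⟩
  · -- non-zero: its coordinate at `1 ⊗ v_j^*` is `χ̃(v_j)`, and `χ̃ ≠ 0` on some basis vector
    intro h0
    apply hχ
    refine b.ext fun j => ?_
    rw [LinearMap.zero_apply]
    let B := Algebra.TensorProduct.basis R b.dualBasis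
    have hf : ∑ j, χt (b j) ⊗ₜ[k] b.coord j = ∑ j, χt (b j) • B j := Finset.sum_congr rfl fun j _ => by
      rw [Algebra.TensorProduct.basis_apply, Module.Basis.coe_dualBasis, TensorProduct.smul_tmul', smul_eq_mul, mul_one]
    have hrepr : B.repr (∑ j, χt (b j) • B j) j = χt (b j) := by
      rw [B.repr_sum_self]
    rw [← hrepr, ← hf, h0, map_zero, Finsupp.zero_apply]
  · -- eigen: expand `v_j^* ∘ T_a` in the dual basis and resum
    have hexp : ∀ j, b.coord j ∘ₗ T a = ∑ i, (b.coord j (T a (b i))) • b.coord i := fun j => by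
      refine b.ext fun i => ?_
      simp only [LinearMap.coe_comp, Function.comp_apply, LinearMap.coe_sum, Finset.sum_apply, LinearMap.smul_apply,
        Module.Basis.coord_apply, Module.Basis.repr_self, smul_eq_mul]
      rw [Finset.sum_eq_single i (fun l _ hli => by rw [Finsupp.single_eq_of_ne hli, mul_zero])
        (fun h => absurd (Finset.mem_univ i) h), Finsupp.single_eq_same, mul_one]
    calc ((T a).dualMap).baseChange R (∑ j, χt (b j) ⊗ₜ[k] b.coord j)
        = ∑ j, χt (b j) ⊗ₜ[k] (b.coord j ∘ₗ T a) := by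
          simp only [map_sum, LinearMap.baseChange_tmul, LinearMap.dualMap_apply']
      _ = ∑ j, ∑ i, ((b.coord j (T a (b i))) • χt (b j)) ⊗ₜ[k] b.coord i := by
          refine Finset.sum_congr rfl fun j _ => ?_
          rw [hexp, TensorProduct.tmul_sum]
          exact Finset.sum_congr rfl fun i _ => by rw [TensorProduct.tmul_smul, TensorProduct.smul_tmul']
      _ = ∑ i, χt (T a (b i)) ⊗ₜ[k] b.coord i := by
          rw [Finset.sum_comm]
          refine Finset.sum_congr rfl fun i _ => ?_
          rw [← TensorProduct.sum_tmul, hsum]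
      _ = c a • ∑ j, χt (b j) ⊗ₜ[k] b.coord j := by
          simp only [hT, Finset.smul_sum, TensorProduct.smul_tmul', smul_eq_mul]

end Literature.LinearAlgebra.BaseChange

/-! ## §2 The non-zero `χ`-eigen dual Tate class of a full-degree rational CM structure -/

namespace Literature.AlgebraicGeometry.ComplexMultiplication

open Literature.AlgebraicGeometry.Motives
open Literature.AlgebraicGeometry.Motives.AbelianVariety (rationalTateAction)

variable {K : Type} [Field K] {A : AbelianVariety K} {ℓ : ℕ} [Fact ℓ.Prime]
  {F : Type*} [Field F] [Algebra ℚ F] [Module.Finite ℚ F]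

/-- `ℚ → ℚ_ℓ → R` is the `ℚ`-algebra structure of a characteristic-zero `ℚ_ℓ`-algebra `R` (uniqueness of `ℚ → R`). [folklore] -/
private theorem isScalarTower_rat_padic'' (R : Type*) [DivisionRing R] [CharZero R] [Algebra ℚ_[ℓ] R] : IsScalarTower ℚ ℚ_[ℓ] R :=
  IsScalarTower.of_algebraMap_eq fun q =>
    (RingHom.congr_fun (Subsingleton.elim ((algebraMap ℚ_[ℓ] R).comp (algebraMap ℚ ℚ_[ℓ])) (algebraMap ℚ R)) q).symm

/-- **(E1) — A NON-ZERO `χ`-EIGEN DUAL TATE CLASS.**  For an abelian variety `A/K` (`ℓ` invertible in `K`), a `ℚ`-algebra `F` with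
`i : F →+* End⁰(A)` and `[F : ℚ] = 2 dim A`, and any ring homomorphism `χ : F → R` into a field `R ⊇ ℚ_ℓ`: there is `f ≠ 0` in
`R ⊗_{ℚ_ℓ} (V_ℓ A)^∨` with `ᵗ(V_ℓ^ℚ(i a)) ⊗ 1 f = χ(a) • f` for all `a ∈ F` — the eigen-covector `χ_ℓ ∘ (F_ℓ ≅ V_ℓ A)⁻¹`
(★ `exists_bijective_cmTateAction`, Serre–Tate Thm. 5 (i)) packaged by §1.
[cite: SerreTate1968, §4 Thm. 5 (i) and Cor. 2] [cite: Shimura1998, §5.1 Prop. 1 (p. 36) (proof)] -/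
theorem _root_.Literature.AlgebraicGeometry.Motives.AbelianVariety.exists_ne_zero_dualMap_rationalTateAction_baseChange_eq_smul
    (hℓ : (ℓ : K) ≠ 0) (i : F →+* A.endAlgebra) (hF : Module.finrank ℚ F = 2 * A.dim)
    (R : Type*) [Field R] [Algebra ℚ_[ℓ] R] (χ : F →+* R) :
    ∃ f : R ⊗[ℚ_[ℓ]] Module.Dual ℚ_[ℓ] (A.rationalTateModule ℓ), f ≠ 0 ∧
      ∀ a : F, ((rationalTateAction A ℓ (i a)).dualMap).baseChange R f = χ a • f := by
  haveI : Module.Finite ℚ_[ℓ] (A.rationalTateModule ℓ) := AbelianVariety.module_finite_rationalTateModule_of_cast_ne_zero A ℓ hℓ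
  haveI : CharZero R := charZero_of_injective_algebraMap (algebraMap ℚ_[ℓ] R).injective
  haveI := isScalarTower_rat_padic'' (ℓ := ℓ) R
  -- `V_ℓ A ≅ F_ℓ`, `s ↦ s · v₀`
  obtain ⟨v₀, hv₀⟩ := exists_bijective_cmTateAction hℓ i hF
  let L : ℚ_[ℓ] ⊗[ℚ] F →ₗ[ℚ_[ℓ]] A.rationalTateModule ℓ := (LinearMap.applyₗ v₀) ∘ₗ (cmTateAction A ℓ i).toLinearMap
  have hLapply : ∀ s, L s = cmTateAction A ℓ i s v₀ := fun _ => rfl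
  have hL : Function.Bijective L := hv₀
  let e := LinearEquiv.ofBijective L hL
  have he : ∀ s, e s = cmTateAction A ℓ i s v₀ := fun _ => rfl
  -- the evaluation `χ_ℓ : F_ℓ → R` at `χ`
  let χℓ : ℚ_[ℓ] ⊗[ℚ] F →ₐ[ℚ_[ℓ]] R :=
    Algebra.TensorProduct.lift (Algebra.ofId ℚ_[ℓ] R) χ.toRatAlgHom fun _ _ => Commute.all _ _
  have hχℓ : ∀ (c : ℚ_[ℓ]) (a : F), χℓ (c ⊗ₜ[ℚ] a) = algebraMap ℚ_[ℓ] R c * χ a := fun c a =>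
    Algebra.TensorProduct.lift_tmul _ _ _ c a
  -- the eigen-covector `χ̃ := χ_ℓ ∘ e⁻¹`
  let χt : A.rationalTateModule ℓ →ₗ[ℚ_[ℓ]] R := χℓ.toLinearMap ∘ₗ e.symm.toLinearMap
  have hχt : ∀ s, χt (e s) = χℓ s := fun s => by
    simp only [χt, LinearMap.coe_comp, Function.comp_apply, LinearEquiv.coe_coe, LinearEquiv.symm_apply_apply, AlgHom.toLinearMap_apply]
  have hχt0 : χt ≠ 0 := by
    intro h0
    have h1 : χt (e 1) = 1 := by rw [hχt, map_one]
    rw [h0, LinearMap.zero_apply] at h1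
    exact zero_ne_one h1
  have hT : ∀ (a : F) (v : A.rationalTateModule ℓ), χt (rationalTateAction A ℓ (i a) v) = χ a * χt v := by
    intro a v
    obtain ⟨s, rfl⟩ := e.surjective v
    have hmul : rationalTateAction A ℓ (i a) (e s) = e (((1 : ℚ_[ℓ]) ⊗ₜ[ℚ] a) * s) := by
      rw [he, he, ← cmTateAction_one_tmul, map_mul, Module.End.mul_apply]
    rw [hmul, hχt, hχt, map_mul, hχℓ, map_one, one_mul]
  exact Literature.LinearAlgebra.BaseChange.exists_ne_zero_dualMap_baseChange_eq_smul_of_linearMap χt hχt0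
    (fun a : F => rationalTateAction A ℓ (i a)) (fun a => χ a) hT

end Literature.AlgebraicGeometry.ComplexMultiplication
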